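import Literature.Analysis.FunctionSpaces.LatticeSymbolAlgebra
import Literature.Analysis.FunctionSpaces.TorusFourierCalculus
import HarnessLib

/-!
# The dictionary between smooth multipliers on `T^d` and lattice convolution (Warner 6.18 (i)–(j))

F. W. Warner (GTM 94 (1983), 6.17–6.18) identifies a smooth periodic (vector-valued) function with
the family of its Fourier coefficients, and 6.18 (i) reads the multiplication by a smooth
(matrix-valued) function `ρ` on the coefficients. This file proves the dictionary used to
transport differential operators with smooth coefficients on the torus to the lattice operators
`Lattice.POp`/`Lattice.POp1`:

* `Torus.mFourierCoeff_clm_apply_of_summable` / `Torus.IsSmooth.mFourierCoeff_clm_apply` — **the product rule**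
  `𝓕(x ↦ ρ(x) g(x))(k) = (𝓕ρ ⋆ 𝓕g)(k) = ∑_l 𝓕ρ(k-l) 𝓕g(l)` (`Lattice.conv`) for a continuous
  operator-valued `ρ` and a continuous `g` with absolutely summable coefficients (expand `g` in its
  Fourier series and integrate termwise; Grafakos 2014, §3.1), in particular for smooth `ρ, g`;
* `Torus.mFourierCoeff_clm_comp` — pointwise composition of two multipliers ↦ `Lattice.sconv`;
* `Torus.mFourierCoeff_smul_eq_conv_scal` — a scalar cutoff `χ • g` ↦ `Lattice.scal (𝓕χ) ⋆ 𝓕g`;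
* `Torus.mFourierCoeff_partialDeriv_eq_freqDeriv` — `𝓕(∂_j g) = ∂_j 𝓕g` (`Lattice.freqDeriv`, the
  tree's `Torus.mFourierCoeff_partialDeriv` restated);
* the smoothness of `x ↦ ρ(x) g(x)`, and Fourier inversion for continuous
  functions with absolutely summable coefficients.

## References

* F. W. Warner, *Foundations of Differentiable Manifolds and Lie Groups*, GTM 94 (1983), 6.17,
  6.18 (i), (j). [WarnerGTM94]
* L. Grafakos, *Classical Fourier Analysis*, 3rd ed., GTM 249 (2014), §3.1, Prop. 3.2.5.
-/

noncomputable section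

open Set Filter Function MeasureTheory UnitAddTorus Complex
open scoped Topology ContDiff

namespace Literature.Analysis.FunctionSpaces

namespace Torus

open Lattice

variable {d : Type*} [Fintype d]
variable {V W X : Type*} [NormedAddCommGroup V] [NormedSpace ℂ V] [NormedAddCommGroup W]
  [NormedSpace ℂ W] [NormedAddCommGroup X] [NormedSpace ℂ X]

/-! ### Smoothness of products -/

/-- `x ↦ ρ(x) (g x)` is smooth for smooth operator-valued `ρ` and smooth `g`. [folklore] -/
theorem IsSmooth.clm_apply {ρ : UnitAddTorus d → (V →L[ℂ] W)} {g : UnitAddTorus d → V}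
    (hρ : IsSmooth ρ) (hg : IsSmooth g) : IsSmooth fun x => ρ x (g x) := by
  have h1 : ContDiff ℝ ∞ fun y => ContinuousLinearMap.restrictScalars ℝ (lift ρ y) :=
    (ContinuousLinearMap.restrictScalarsIsometry ℂ V W ℝ ℝ).toContinuousLinearMap.contDiff.comp hρ
  exact h1.clm_apply hg

/-- `x ↦ χ(x) • g(x)` is smooth for a smooth scalar `χ` and smooth `g`. [folklore] -/
theorem IsSmooth.smul_complex {χ : UnitAddTorus d → ℂ} {g : UnitAddTorus d → V} (hχ : IsSmooth χ)
    (hg : IsSmooth g) : IsSmooth fun x => χ x • g x :=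
  ContDiff.smul hχ hg

/-! ### Fourier inversion for continuous functions with absolutely summable coefficients -/

variable [DecidableEq d]

section Inversion

variable [CompleteSpace V]

omit [DecidableEq d] in
/-- **Fourier inversion**: a continuous `g` with absolutely summable coefficients is the synthesis of
its coefficients, `g = ∑_k e_k • 𝓕g(k)` (both sides are continuous with the same coefficients).
[cite: Grafakos2014, Prop. 3.2.5] -/
theorem fourierSynth_mFourierCoeff_of_summable {g : UnitAddTorus d → V} (hg : Continuous g)
    (hs : Summable fun k => ‖mFourierCoeff g k‖) : fourierSynth (mFourierCoeff g) = g := by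
  have hdiff : (fun x => fourierSynth (mFourierCoeff g) x - g x) = 0 := by
    refine eq_zero_of_forall_mFourierCoeff_eq_zero ((continuous_tsum_mFourier_smul hs).sub hg) fun k => ?_
    have hint : Integrable (fourierSynth (mFourierCoeff g)) volume :=
      (continuous_tsum_mFourier_smul hs).integrable_unitAddTorus
    rw [show (fun x => fourierSynth (mFourierCoeff g) x - g x) = fourierSynth (mFourierCoeff g) - g from rfl,
      mFourierCoeff_sub hint hg.integrable_unitAddTorus]
    unfold fourierSynth
    rw [mFourierCoeff_tsum_mFourier_smul hs, sub_self]
  funext x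
  have := congrFun hdiff x
  simpa [sub_eq_zero] using this

end Inversion

/-! ### The Fourier coefficients of operator-valued functions -/

omit [DecidableEq d] in
/-- Evaluating an operator-valued function at a fixed vector commutes with taking Fourier
coefficients: `𝓕(x ↦ ρ(x) v)(n) = 𝓕ρ(n) v`. [folklore] -/
theorem mFourierCoeff_clm_apply_const {ρ : UnitAddTorus d → (V →L[ℂ] W)} (hρ : Continuous ρ) (v : V)
    (n : d → ℤ) : mFourierCoeff (fun x => ρ x v) n = mFourierCoeff ρ n v := by
  have hc : Continuous fun x => mFourier (-n) x • ρ x := (mFourier (-n)).continuous.smul hρ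
  rw [mFourierCoeff_eq_integral_volume, mFourierCoeff_eq_integral_volume,
    ContinuousLinearMap.integral_apply hc.integrable_unitAddTorus v]
  rfl

omit [DecidableEq d] in
/-- A continuous linear map applied to a function commutes with taking Fourier coefficients:
`𝓕(T ∘ ρ)(n) = T (𝓕ρ(n))`. [folklore] -/
theorem mFourierCoeff_comp_clm [CompleteSpace V] {Y : Type*} [NormedAddCommGroup Y] [NormedSpace ℂ Y]
    [CompleteSpace Y] (T : V →L[ℂ] Y) {g : UnitAddTorus d → V} (hg : Continuous g) (n : d → ℤ) :
    mFourierCoeff (fun x => T (g x)) n = T (mFourierCoeff g n) := by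
  have hc : Continuous fun x => mFourier (-n) x • g x := (mFourier (-n)).continuous.smul hg
  rw [mFourierCoeff_eq_integral_volume, mFourierCoeff_eq_integral_volume, ← T.integral_comp_comm hc.integrable_unitAddTorus]
  exact integral_congr_ae (Eventually.of_forall fun x => (T.map_smul _ _).symm)

/-! ### The product rule -/

section Product

variable [CompleteSpace V]

omit [DecidableEq d] in
/-- **The product rule** (Warner 6.18 (i) on the coefficients; Grafakos 2014, §3.1): for a
continuous operator-valued `ρ` and a continuous `g` with absolutely summable Fourier coefficients,

  `𝓕(x ↦ ρ(x) g(x))(k) = ∑_l 𝓕ρ(k - l) (𝓕g(l)) = (𝓕ρ ⋆ 𝓕g)(k)`   (`Lattice.conv`).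

Proof: expand `g = ∑_l e_l • 𝓕g(l)` (absolutely, uniformly), exchange sum and integral, and use
`e_{-k} e_l = e_{-(k-l)}`. [cite: WarnerGTM94, 6.18 (i)] -/
theorem mFourierCoeff_clm_apply_of_summable {ρ : UnitAddTorus d → (V →L[ℂ] W)} (hρ : Continuous ρ)
    {g : UnitAddTorus d → V} (hg : Continuous g) (hgs : Summable fun k => ‖mFourierCoeff g k‖)
    (k : d → ℤ) :
    mFourierCoeff (fun x => ρ x (g x)) k = conv (mFourierCoeff ρ) (mFourierCoeff g) k := by
  rw [conv_apply, mFourierCoeff_eq_integral_volume]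
  obtain ⟨G, hG⟩ := isCompact_univ.exists_bound_of_continuousOn hρ.continuousOn
  -- the terms of the expanded integrand
  obtain ⟨F, hF⟩ : ∃ F : (d → ℤ) → UnitAddTorus d → W,
      ∀ m x, F m x = (mFourier (-k) x * mFourier m x) • ρ x (mFourierCoeff g m) := ⟨_, fun _ _ => rfl⟩
  have hFint : ∀ m, Integrable (F m) volume := fun m => by
    have : F m = fun x => (mFourier (-k) x * mFourier m x) • ρ x (mFourierCoeff g m) := funext (hF m)
    rw [this]
    exact ((((mFourier (-k)).continuous.mul (mFourier m).continuous)).smul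
      (hρ.clm_apply continuous_const)).integrable_unitAddTorus
  have hFnorm : ∀ m x, ‖F m x‖ ≤ G * ‖mFourierCoeff g m‖ := fun m x => by
    rw [hF, norm_smul, norm_mul, norm_mFourier_apply, norm_mFourier_apply, one_mul, one_mul]
    exact ((ρ x).le_opNorm _).trans (mul_le_mul_of_nonneg_right (hG x (mem_univ x)) (norm_nonneg _))
  have hG0 : 0 ≤ G := (norm_nonneg _).trans (hG 0 (mem_univ _))
  have hsum : Summable fun m => ∫ x, ‖F m x‖ := by
    refine Summable.of_nonneg_of_le (fun m => integral_nonneg fun x => norm_nonneg _) (fun m => ?_)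
      (hgs.mul_left G)
    calc ∫ x, ‖F m x‖ ≤ ∫ _ : UnitAddTorus d, G * ‖mFourierCoeff g m‖ :=
          integral_mono (hFint m).norm (integrable_const _) (hFnorm m)
      _ = G * ‖mFourierCoeff g m‖ := by simp
  have hexch := integral_tsum_of_summable_integral_norm hFint hsum
  -- pointwise expansion of the integrand
  have hsyn : ∀ x, g x = ∑' m, mFourier m x • mFourierCoeff g m := fun x => by
    have := congrFun (fourierSynth_mFourierCoeff_of_summable hg hgs) x
    exact this.symm
  have hpt : ∀ x, mFourier (-k) x • ρ x (g x) = ∑' m, F m x := fun x => by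
    rw [hsyn x, (ρ x).map_tsum (hasSum_mFourier_smul hgs x).summable, ← tsum_const_smul'' (mFourier (-k) x)]
    refine tsum_congr fun m => ?_
    rw [hF, (ρ x).map_smul, smul_smul]
  simp_rw [hpt]
  rw [← hexch]
  refine tsum_congr fun m => ?_
  have : F m = fun x => mFourier (-(k - m)) x • ρ x (mFourierCoeff g m) := by
    funext x
    rw [hF, ← mFourier_add, show -k + m = -(k - m) by abel]
  rw [this, ← mFourierCoeff_eq_integral_volume, mFourierCoeff_clm_apply_const hρ]

/-- The product rule for smooth `ρ`, `g`. [cite: WarnerGTM94, 6.18 (i)] -/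
theorem IsSmooth.mFourierCoeff_clm_apply {ρ : UnitAddTorus d → (V →L[ℂ] W)} (hρ : IsSmooth ρ)
    {g : UnitAddTorus d → V} (hg : IsSmooth g) (k : d → ℤ) :
    mFourierCoeff (fun x => ρ x (g x)) k = conv (mFourierCoeff ρ) (mFourierCoeff g) k :=
  mFourierCoeff_clm_apply_of_summable hρ.continuous hg.continuous hg.rapidDecay_mFourierCoeff.summable_norm k

/-- The product rule as an identity of coefficient families. [cite: WarnerGTM94, 6.18 (i)] -/
theorem IsSmooth.mFourierCoeff_clm_apply' {ρ : UnitAddTorus d → (V →L[ℂ] W)} (hρ : IsSmooth ρ)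
    {g : UnitAddTorus d → V} (hg : IsSmooth g) :
    mFourierCoeff (fun x => ρ x (g x)) = conv (mFourierCoeff ρ) (mFourierCoeff g) :=
  funext fun k => hρ.mFourierCoeff_clm_apply hg k

end Product

/-! ### Composition of multipliers, scalar cutoffs, derivatives -/

section Consequences

variable [CompleteSpace V] [CompleteSpace W] [CompleteSpace X]

omit [CompleteSpace V] in
/-- **Pointwise composition of multipliers is the symbol product**:
`𝓕(x ↦ ρ(x) ∘ η(x)) = 𝓕ρ ⋆ 𝓕η` (`Lattice.sconv`; test on a vector `v` and use the product rule for
`x ↦ ρ(x) (η(x) v)`). [folklore] -/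
theorem IsSmooth.mFourierCoeff_clm_comp {ρ : UnitAddTorus d → (W →L[ℂ] X)} (hρ : IsSmooth ρ)
    {η : UnitAddTorus d → (V →L[ℂ] W)} (hη : IsSmooth η) :
    mFourierCoeff (fun x => (ρ x).comp (η x)) = sconv (mFourierCoeff ρ) (mFourierCoeff η) := by
  funext k
  ext v
  have hc : Continuous fun x => (ρ x).comp (η x) := hρ.continuous.clm_comp hη.continuous
  have hηv : IsSmooth fun x => η x v := hη.clm_apply (isSmooth_const v)
  have happ : (∑' l, (mFourierCoeff ρ (k - l)).comp (mFourierCoeff η l)) v =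
      ∑' l, ((mFourierCoeff ρ (k - l)).comp (mFourierCoeff η l)) v := by
    simpa only [ContinuousLinearMap.apply_apply] using (ContinuousLinearMap.apply ℂ X v).map_tsum
      (summable_norm_sconv_term hρ.rapidDecay_mFourierCoeff hη.rapidDecay_mFourierCoeff k).of_norm
  rw [← mFourierCoeff_clm_apply_const hc v k, sconv_apply, happ]
  simp only [ContinuousLinearMap.comp_apply]
  rw [mFourierCoeff_clm_apply_of_summable hρ.continuous hηv.continuous hηv.rapidDecay_mFourierCoeff.summable_norm,
    conv_apply]
  exact tsum_congr fun l => by rw [mFourierCoeff_clm_apply_const hη.continuous v l]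

/-- **A scalar cutoff is the scalar symbol**: `𝓕(χ • g) = scal(𝓕χ) ⋆ 𝓕g`. [folklore] -/
theorem IsSmooth.mFourierCoeff_smul_eq_conv_scal {χ : UnitAddTorus d → ℂ} (hχ : IsSmooth χ)
    {g : UnitAddTorus d → V} (hg : IsSmooth g) :
    mFourierCoeff (fun x => χ x • g x) = conv (scal (mFourierCoeff χ)) (mFourierCoeff g) := by
  funext k
  have h1 : (fun x => χ x • g x) = fun x => (χ x • (1 : V →L[ℂ] V)) (g x) := rfl
  have hΩ : Continuous fun x => χ x • (1 : V →L[ℂ] V) := hχ.continuous.smul continuous_const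
  rw [h1, mFourierCoeff_clm_apply_of_summable hΩ hg.continuous hg.rapidDecay_mFourierCoeff.summable_norm, conv_apply,
    conv_apply]
  refine tsum_congr fun l => ?_
  congr 1
  have hT : (fun x => χ x • (1 : V →L[ℂ] V)) =
      fun x => ((ContinuousLinearMap.id ℂ ℂ).smulRight (1 : V →L[ℂ] V)) (χ x) := by
    funext x; simp
  rw [scal_apply, hT, mFourierCoeff_comp_clm _ hχ.continuous]
  simp

omit [CompleteSpace V] [CompleteSpace W] [CompleteSpace X] in
/-- The scalar symbol of a smooth function is rapidly decreasing. [folklore] -/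
theorem IsSmooth.rapidDecay_scal {χ : UnitAddTorus d → ℂ} (hχ : IsSmooth χ) :
    RapidDecay (scal (mFourierCoeff χ) : (d → ℤ) → (V →L[ℂ] V)) :=
  hχ.rapidDecay_mFourierCoeff.scal

omit [CompleteSpace V] [CompleteSpace W] [CompleteSpace X] in
/-- **Derivatives are the frequency multipliers**: `𝓕(∂_j g) = ∂_j 𝓕g` (`Lattice.freqDeriv`).
[cite: WarnerGTM94, 6.17] -/
theorem IsSmooth.mFourierCoeff_partialDeriv_eq_freqDeriv {g : UnitAddTorus d → V}
    (hg : IsSmooth g) (j : d) : mFourierCoeff (Torus.partialDeriv j g) = freqDeriv j (mFourierCoeff g) :=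
  funext fun k => mFourierCoeff_partialDeriv hg j k

end Consequences

end Torus

end Literature.Analysis.FunctionSpaces
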